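import Mathlib
import HarnessLib
import Literature.Combinatorics.SimpleGraph.FKPseudomoments
import Summits.PneNP.PneNP.Theorems.RamseyUncertifiablePaleySosRungShellConst
import Summits.PneNP.PneNP.Theorems.RamseyUncertifiablePaleySosRungShellPattern

/-!
# The filled-matrix shell: `stub_filledShell` (crux `PaleySosRung`, line `weil-patch-transfer`)

For every level `t ≥ 1` there are `η = 1/(16t) > 0` and `m₀` such that every graph `G` on `Fin m`,
`m ≥ m₀`, whose rectangular MPW cross matrices `R_{a,b}` (`1 ≤ a, b ≤ t`) satisfy the bilinear
bounds `|uᵀ R_{a,b} v| ≤ m^{(a+b)/2 − 1/8} ‖u‖ ‖v‖` admits Feige–Krauthgamer levels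
`α_k = κ_k α^k` (`κ_k = 2^{C(k,2)} 8^{k²}`, `α = m^{η − 1}`) with `α_0 = 1`, `m^η ≤ m · α_1` and a
positive semidefinite level-`t` filled matrix
`H[L,R] = α_{|L∪R|} · bipInd G L R − α_{|L|} α_{|R|}` (nonempty `L, R` of size `≤ t`).

Proof: `H = C + P` with the constant part `C[L,R] = α_{|L∪R|} 2^{-|L∖R||R∖L|} − α_{|L|}α_{|R|}`,
bounded below by `(4/7) Σ_L α_{|L|} x_L²` (`constPart_lower`, part 3), and the pattern part
`P[L,R] = α_{|L∪R|}(bipInd − 2^{-|L∖R||R∖L|})`, bounded in absolute value by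
`(2/7) Σ_L α_{|L|} x_L²` (`shell_patternPart` with `ε = 2/(7t²)`, `N(a,b) = m^{(a+b)/2−1/8}`);
the two smallness conditions `(t+1)·2^tκ_{2t}2^{t²}·α ≤ 1/7` and
`κ_{2t}² 4^t ≤ ε² m^{1/8}` hold for `m ≥ m₀`.
-/

set_option linter.dupNamespace false -- `Summit.PneNP.PneNP.…`: summit = sub-problem (D-0017)

namespace Summit.PneNP.PneNP.Theorems.PaleySosRungWeilPatch

open Finset Matrix Literature.Combinatorics.SimpleGraph

-- The level weight `κ_k = 2^{C(k,2)} · 8^{k²}` (local notation, as in parts 1–3).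
local notation3 "κ[" k "]" => ((2 : ℝ) ^ (Nat.choose k 2) * (8 : ℝ) ^ (k ^ 2))

/-- `bipInd` is symmetric. -/
theorem bipInd_comm {V : Type*} [DecidableEq V] (G : SimpleGraph V) [DecidableRel G.Adj]
    (L R : Finset V) : bipInd G L R = bipInd G R L := by
  rw [bipInd_apply, bipInd_apply]
  by_cases h : ∀ v ∈ L \ R, ∀ w ∈ R \ L, G.Adj v w
  · rw [if_pos h, if_pos (fun w hw v hv => (h v hv w hw).symm)]
  · rw [if_neg h, if_neg (fun h' => h (fun v hv w hw => (h' w hw v hv).symm))]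

/-- Sums over the nonempty-bounded-size subtype are sums over all subsets of a function vanishing
elsewhere. -/
theorem sum_idx_eq_sum {m t : ℕ} (h : Finset (Fin m) → ℝ)
    (hh : ∀ S : Finset (Fin m), ¬ (1 ≤ S.card ∧ S.card ≤ t) → h S = 0) :
    ∑ L : {S : Finset (Fin m) // 1 ≤ S.card ∧ S.card ≤ t}, h L.1 = ∑ S : Finset (Fin m), h S := by
  rw [← Finset.sum_subtype (Finset.univ.filter fun S : Finset (Fin m) => 1 ≤ S.card ∧ S.card ≤ t)
    (fun S => by simp) h, Finset.sum_filter]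
  exact Finset.sum_congr rfl fun S _ => by
    by_cases hS : 1 ≤ S.card ∧ S.card ≤ t
    · rw [if_pos hS]
    · rw [if_neg hS, hh S hS]

set_option maxHeartbeats 400000 in
/-- **(S) The elementary filled-matrix shell** — registered stub `stub_filledShell` of crux
stmt-PneNP-9817 (line `weil-patch-transfer`). -/
theorem stub_filledShell :
    ∀ t : ℕ, 1 ≤ t → ∃ η : ℝ, 0 < η ∧ ∃ m₀ : ℕ, ∀ m ≥ m₀, ∀ (G : SimpleGraph (Fin m)) [DecidableRel G.Adj],
      (∀ a b : ℕ, 1 ≤ a → a ≤ t → 1 ≤ b → b ≤ t →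
        ∀ (u : {S : Finset (Fin m) // S.card = a} → ℝ) (v : {S : Finset (Fin m) // S.card = b} → ℝ),
          |∑ A, ∑ B, u A * v B *
              (if Disjoint A.1 B.1 then
                (if ∀ x ∈ A.1, ∀ y ∈ B.1, G.Adj x y then (2 : ℝ) ^ (a * b) - 1 else -1)
               else 0)|
            ≤ (m : ℝ) ^ (((a + b : ℕ) : ℝ) / 2 - 1 / 8) *
                Real.sqrt (∑ A, u A ^ 2) * Real.sqrt (∑ B, v B ^ 2)) →
      ∃ α : ℕ → ℝ, α 0 = 1 ∧ (m : ℝ) ^ η ≤ (m : ℝ) * α 1 ∧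
        (Matrix.of fun L R : {S : Finset (Fin m) // 1 ≤ S.card ∧ S.card ≤ t} =>
          α (L.1 ∪ R.1).card * bipInd G L.1 R.1 - α L.1.card * α R.1.card).PosSemidef := by
  intro t ht
  have htR : (1 : ℝ) ≤ t := by exact_mod_cast ht
  have ht0 : (0 : ℝ) < t := by linarith
  -- constants
  set Kt : ℝ := 2 ^ t * κ[2 * t] * 2 ^ (t ^ 2) with hKt
  set ε : ℝ := 2 / (7 * (t : ℝ) ^ 2) with hε
  set KB : ℝ := κ[2 * t] ^ 2 * 4 ^ t / ε ^ 2 with hKB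
  set η : ℝ := 1 / (16 * (t : ℝ)) with hη
  have hKt0 : 0 < Kt := by positivity
  have hε0 : 0 < ε := by positivity
  have hKB0 : 0 < KB := by positivity
  have hη0 : 0 < η := by positivity
  have hη16 : η ≤ 1 / 16 := by
    rw [hη, div_le_div_iff₀ (by positivity) (by norm_num)]
    linarith
  have hηt : η * (2 * t) = 1 / 8 := by
    rw [hη]; field_simp; ring
  refine ⟨η, hη0, max 2 (max ⌈(7 * ((t : ℝ) + 1) * Kt) ^ 2⌉₊ ⌈KB ^ 8⌉₊), ?_⟩
  intro m hm G _ hcross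
  -- size facts
  have hm2 : 2 ≤ m := le_trans (le_max_left _ _) hm
  have hmR1 : (1 : ℝ) < m := by exact_mod_cast (lt_of_lt_of_le one_lt_two hm2)
  have hm1 : (1 : ℝ) ≤ m := hmR1.le
  have hm0 : (0 : ℝ) < m := by linarith
  have hM1 : (7 * ((t : ℝ) + 1) * Kt) ^ 2 ≤ (m : ℝ) :=
    (Nat.le_ceil _).trans (by exact_mod_cast (le_max_left _ _).trans ((le_max_right _ _).trans hm))
  have hM2 : KB ^ 8 ≤ (m : ℝ) :=
    (Nat.le_ceil _).trans (by exact_mod_cast (le_max_right _ _).trans ((le_max_right _ _).trans hm))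
  -- the base `α = m^{η-1}`
  set αr : ℝ := (m : ℝ) ^ (η - 1) with hαr
  have hαr0 : 0 < αr := Real.rpow_pos_of_pos hm0 _
  have hαr1 : αr ≤ 1 := Real.rpow_le_one_of_one_le_of_nonpos hm1 (by linarith)
  have hαm : αr * m = (m : ℝ) ^ η := by
    rw [hαr, Real.rpow_sub_one hm0.ne']
    field_simp
  -- (b) the Step-A smallness `(t+1)·Kt·α ≤ 1/7`
  have hsmall : ((t : ℝ) + 1) * (2 ^ t * κ[2 * t] * 2 ^ (t ^ 2)) * αr ≤ 1 / 7 := by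
    rw [← hKt]
    have hsq : 7 * ((t : ℝ) + 1) * Kt ≤ Real.sqrt m := by
      rw [← Real.sqrt_sq (by positivity : (0 : ℝ) ≤ 7 * ((t : ℝ) + 1) * Kt)]
      exact Real.sqrt_le_sqrt hM1
    have hαle : αr ≤ (Real.sqrt m)⁻¹ := by
      rw [hαr, Real.sqrt_eq_rpow, ← Real.rpow_neg hm0.le]
      exact Real.rpow_le_rpow_of_exponent_le hm1 (by linarith)
    have hspos : 0 < Real.sqrt m := Real.sqrt_pos.2 hm0
    calc ((t : ℝ) + 1) * Kt * αr ≤ ((t : ℝ) + 1) * Kt * (Real.sqrt m)⁻¹ := by gcongr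
      _ ≤ ((t : ℝ) + 1) * Kt * (7 * ((t : ℝ) + 1) * Kt)⁻¹ := by
          gcongr
      _ = 1 / 7 := by field_simp
  -- the levels
  refine ⟨fun k => κ[k] * αr ^ k, by simp, ?_, ?_⟩
  · -- value: `m^η ≤ m · 8 α = 8 m^η`
    have h8 : (m : ℝ) * (κ[1] * αr ^ 1) = 8 * (m : ℝ) ^ η := by
      rw [← hαm]; simp; ring
    rw [h8]
    have : 0 ≤ (m : ℝ) ^ η := Real.rpow_nonneg hm0.le _
    linarith
  · -- positive semidefiniteness
    set lev : ℕ → ℝ := fun k => κ[k] * αr ^ k with hlev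
    have hlevpos : ∀ n, 0 < lev n := fun n => by simp only [hlev]; positivity
    refine Matrix.PosSemidef.of_dotProduct_mulVec_nonneg ?_ fun y => ?_
    · -- Hermitian (real symmetric)
      ext L R
      simp only [conjTranspose_apply, star_trivial, Matrix.of_apply]
      rw [Finset.union_comm, bipInd_comm G R.1 L.1, mul_comm (κ[R.1.card] * αr ^ R.1.card)]
    · -- the quadratic form
      set x : Finset (Fin m) → ℝ := fun S =>
        if h : 1 ≤ S.card ∧ S.card ≤ t then y ⟨S, h⟩ else 0 with hx
      have hxout : ∀ S : Finset (Fin m), ¬ (1 ≤ S.card ∧ S.card ≤ t) → x S = 0 := by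
        intro S hS; simp only [hx, dif_neg hS]
      have hx0 : x ∅ = 0 := hxout ∅ (by simp)
      have hxt : ∀ L : Finset (Fin m), t < L.card → x L = 0 := fun L hL => hxout L (by omega)
      have hxin : ∀ L : {S : Finset (Fin m) // 1 ≤ S.card ∧ S.card ≤ t}, x L.1 = y L := by
        intro L; simp only [hx, dif_pos L.2]
      -- the form as a double sum over all subsets
      set F : Finset (Fin m) → Finset (Fin m) → ℝ := fun S S' =>
        lev (S ∪ S').card * bipInd G S S' - lev S.card * lev S'.card with hF
      have hform : star y ⬝ᵥ ((Matrix.of fun L R : {S : Finset (Fin m) // 1 ≤ S.card ∧ S.card ≤ t} =>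
            κ[(L.1 ∪ R.1).card] * αr ^ (L.1 ∪ R.1).card * bipInd G L.1 R.1 -
              κ[L.1.card] * αr ^ L.1.card * (κ[R.1.card] * αr ^ R.1.card)) *ᵥ y) =
          ∑ S : Finset (Fin m), ∑ S' : Finset (Fin m), x S * x S' * F S S' := by
        have h1 : star y ⬝ᵥ ((Matrix.of fun L R : {S : Finset (Fin m) // 1 ≤ S.card ∧ S.card ≤ t} =>
            κ[(L.1 ∪ R.1).card] * αr ^ (L.1 ∪ R.1).card * bipInd G L.1 R.1 -
              κ[L.1.card] * αr ^ L.1.card * (κ[R.1.card] * αr ^ R.1.card)) *ᵥ y) =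
            ∑ L : {S : Finset (Fin m) // 1 ≤ S.card ∧ S.card ≤ t},
              ∑ R : {S : Finset (Fin m) // 1 ≤ S.card ∧ S.card ≤ t}, x L.1 * x R.1 * F L.1 R.1 := by
          simp only [star_trivial, dotProduct, mulVec, Matrix.of_apply, Finset.mul_sum, hF, hlev, hxin]
          refine Finset.sum_congr rfl fun L _ => Finset.sum_congr rfl fun R _ => ?_
          ring
        rw [h1]
        rw [sum_idx_eq_sum (fun S => ∑ R : {S : Finset (Fin m) // 1 ≤ S.card ∧ S.card ≤ t},
          x S * x R.1 * F S R.1) (fun S hS => by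
            refine Finset.sum_eq_zero fun R _ => ?_
            rw [hxout S hS, zero_mul, zero_mul])]
        refine Finset.sum_congr rfl fun S _ => ?_
        exact sum_idx_eq_sum (fun S' => x S * x S' * F S S') (fun S' hS' => by
          rw [hxout S' hS', mul_zero, zero_mul])
      rw [hform]
      -- split `F = constant part + pattern part`
      have hsplit : ∑ S : Finset (Fin m), ∑ S' : Finset (Fin m), x S * x S' * F S S' =
          (∑ S : Finset (Fin m), ∑ S' : Finset (Fin m), x S * x S' *
            (κ[(S ∪ S').card] * αr ^ (S ∪ S').card / 2 ^ ((S \ S').card * (S' \ S).card) -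
              κ[S.card] * αr ^ S.card * (κ[S'.card] * αr ^ S'.card))) +
          ∑ S : Finset (Fin m), ∑ S' : Finset (Fin m), x S * x S' *
            (lev (S ∪ S').card * (bipInd G S S' - 1 / 2 ^ ((S \ S').card * (S' \ S).card))) := by
        rw [← Finset.sum_add_distrib]
        refine Finset.sum_congr rfl fun S _ => ?_
        rw [← Finset.sum_add_distrib]
        refine Finset.sum_congr rfl fun S' _ => ?_
        simp only [hF, hlev]
        ring
      rw [hsplit]
      -- Step A
      have hA := constPart_lower t hαr0 hαr1 hsmall x hx0 hxt
      -- Step B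
      have hB := shell_patternPart m t G (fun a b => (m : ℝ) ^ (((a + b : ℕ) : ℝ) / 2 - 1 / 8)) lev ε
        hε0.le hlevpos (fun a b => Real.rpow_nonneg hm0.le _)
        (fun a b ha hat hb hbt u v => hcross a b ha hat hb hbt u v) ?_ x hx0 hxt
      · have hεt : ε * t ^ 2 = 2 / 7 := by
          rw [hε]; field_simp
        rw [hεt] at hB
        have hS0 : 0 ≤ ∑ L : Finset (Fin m), lev L.card * x L ^ 2 :=
          Finset.sum_nonneg fun L _ => mul_nonneg (hlevpos _).le (sq_nonneg _)
        have hlevsum : ∑ L : Finset (Fin m), κ[L.card] * αr ^ L.card * x L ^ 2 =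
            ∑ L : Finset (Fin m), lev L.card * x L ^ 2 := by simp only [hlev]
        rw [hlevsum] at hA
        set Acst := ∑ S : Finset (Fin m), ∑ S' : Finset (Fin m), x S * x S' *
            (κ[(S ∪ S').card] * αr ^ (S ∪ S').card / 2 ^ ((S \ S').card * (S' \ S).card) -
              κ[S.card] * αr ^ S.card * (κ[S'.card] * αr ^ S'.card)) with hAcst
        set Ppat := ∑ S : Finset (Fin m), ∑ S' : Finset (Fin m), x S * x S' *
            (lev (S ∪ S').card * (bipInd G S S' - 1 / 2 ^ ((S \ S').card * (S' \ S).card)))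
          with hPpat
        set SL := ∑ L : Finset (Fin m), lev L.card * x L ^ 2 with hSL
        have hP : -(2 / 7 * SL) ≤ Ppat := (neg_le_neg hB).trans (neg_abs_le _)
        have h0 : (0 : ℝ) ≤ 4 / 7 * SL + -(2 / 7 * SL) := by nlinarith [hS0]
        exact h0.trans (add_le_add hA hP)
      · -- (c) the parameter condition of Step B
        intro a b s ha hb has hbs
        have hab2t : a + b ≤ 2 * t := by omega
        -- `N(a,b)² = m^{a+b} · m^{-1/4}`
        have hN2 : ((m : ℝ) ^ (((a + b : ℕ) : ℝ) / 2 - 1 / 8)) ^ 2 =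
            (m : ℝ) ^ (a + b) * (m : ℝ) ^ (-(1 / 4 : ℝ)) := by
          rw [← Real.rpow_natCast _ 2, ← Real.rpow_mul hm0.le, ← Real.rpow_natCast _ (a + b),
            ← Real.rpow_add hm0]
          congr 1
          push_cast
          ring
        -- `α^{2(a+b+s)} m^{a+b} = α^{a+b+2s} (αm)^{a+b} ≤ α^{a+b+2s} m^{1/8}`
        have hpow : αr ^ (a + b) * (m : ℝ) ^ (a + b) ≤ (m : ℝ) ^ (1 / 8 : ℝ) := by
          rw [← mul_pow, hαm, ← Real.rpow_natCast, ← Real.rpow_mul hm0.le]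
          refine Real.rpow_le_rpow_of_exponent_le hm1 ?_
          rw [← hηt]
          push_cast
          have : (a : ℝ) + b ≤ 2 * t := by exact_mod_cast hab2t
          nlinarith
        -- the constant against `m^{1/8}`
        have hm8 : KB ≤ (m : ℝ) ^ (1 / 8 : ℝ) := by
          have hm88 : ((m : ℝ) ^ (1 / 8 : ℝ)) ^ (8 : ℕ) = m := by
            rw [← Real.rpow_natCast, ← Real.rpow_mul hm0.le]
            norm_num
          have h : KB ^ 8 ≤ ((m : ℝ) ^ (1 / 8 : ℝ)) ^ 8 := by rw [hm88]; exact hM2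
          exact (pow_le_pow_iff_left₀ hKB0.le (Real.rpow_nonneg hm0.le _) (by norm_num)).1 h
        have hC1 : ((a + s).choose s : ℝ) ≤ 2 ^ t := by
          have h1 : (a + s).choose s ≤ 2 ^ (a + s) := Nat.choose_le_two_pow _ _
          have h2 : (2 : ℝ) ^ (a + s) ≤ 2 ^ t := pow_le_pow_right₀ (by norm_num) has
          exact le_trans (by exact_mod_cast h1) h2
        have hC2 : ((b + s).choose s : ℝ) ≤ 2 ^ t := by
          have h1 : (b + s).choose s ≤ 2 ^ (b + s) := Nat.choose_le_two_pow _ _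
          have h2 : (2 : ℝ) ^ (b + s) ≤ 2 ^ t := pow_le_pow_right₀ (by norm_num) hbs
          exact le_trans (by exact_mod_cast h1) h2
        have hk1 : κ[a + b + s] ≤ κ[2 * t] := kap_le_kap (by omega)
        have hk2 : (1 : ℝ) ≤ κ[a + s] := one_le_kap _
        have hk3 : (1 : ℝ) ≤ κ[b + s] := one_le_kap _
        have hm18 : (m : ℝ) ^ (1 / 8 : ℝ) * (m : ℝ) ^ (-(1 / 4 : ℝ)) = ((m : ℝ) ^ (1 / 8 : ℝ))⁻¹ := by
          rw [← Real.rpow_add hm0, ← Real.rpow_neg hm0.le]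
          norm_num
        have hm8pos : 0 < (m : ℝ) ^ (1 / 8 : ℝ) := Real.rpow_pos_of_pos hm0 _
        -- main estimate
        simp only [hlev]
        have hLHS : (κ[a + b + s] * αr ^ (a + b + s) / 2 ^ (a * b) *
              (m : ℝ) ^ (((a + b : ℕ) : ℝ) / 2 - 1 / 8)) ^ 2 *
            (((a + s).choose s : ℝ) * ((b + s).choose s : ℝ)) ≤
            (κ[2 * t] ^ 2 * 4 ^ t) * ((m : ℝ) ^ (1 / 8 : ℝ))⁻¹ * αr ^ (a + b + 2 * s) := by
          have hdiv : (κ[a + b + s] * αr ^ (a + b + s) / 2 ^ (a * b) *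
              (m : ℝ) ^ (((a + b : ℕ) : ℝ) / 2 - 1 / 8)) ^ 2 ≤
              (κ[a + b + s] * αr ^ (a + b + s) * (m : ℝ) ^ (((a + b : ℕ) : ℝ) / 2 - 1 / 8)) ^ 2 := by
            apply pow_le_pow_left₀ (by positivity)
            rw [div_mul_eq_mul_div]
            exact div_le_self (by positivity) (one_le_pow₀ (by norm_num))
          calc _ ≤ (κ[a + b + s] * αr ^ (a + b + s) * (m : ℝ) ^ (((a + b : ℕ) : ℝ) / 2 - 1 / 8)) ^ 2 *
                (((a + s).choose s : ℝ) * ((b + s).choose s : ℝ)) :=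
                mul_le_mul_of_nonneg_right hdiv (by positivity)
            _ = κ[a + b + s] ^ 2 * (((a + s).choose s : ℝ) * ((b + s).choose s : ℝ)) *
                  (αr ^ (a + b) * (m : ℝ) ^ (a + b)) * (m : ℝ) ^ (-(1 / 4 : ℝ)) *
                  αr ^ (a + b + 2 * s) := by
                rw [mul_pow, mul_pow, hN2]; ring
            _ ≤ κ[2 * t] ^ 2 * (2 ^ t * 2 ^ t) * (m : ℝ) ^ (1 / 8 : ℝ) * (m : ℝ) ^ (-(1 / 4 : ℝ)) *
                  αr ^ (a + b + 2 * s) := by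
                gcongr
            _ = (κ[2 * t] ^ 2 * 4 ^ t) * ((m : ℝ) ^ (1 / 8 : ℝ))⁻¹ * αr ^ (a + b + 2 * s) := by
                rw [mul_assoc (κ[2 * t] ^ 2 * (2 ^ t * 2 ^ t)), hm18, ← mul_pow]
                norm_num
        refine hLHS.trans ?_
        have hRHS : ε ^ 2 * αr ^ (a + b + 2 * s) ≤
            ε ^ 2 * (κ[a + s] * αr ^ (a + s) * (κ[b + s] * αr ^ (b + s))) := by
          have : αr ^ (a + b + 2 * s) = 1 * αr ^ (a + s) * (1 * αr ^ (b + s)) := by ring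
          rw [this]
          gcongr
        refine le_trans ?_ hRHS
        rw [hKB] at hm8
        have h1 : κ[2 * t] ^ 2 * 4 ^ t / ε ^ 2 * ε ^ 2 ≤ (m : ℝ) ^ (1 / 8 : ℝ) * ε ^ 2 :=
          mul_le_mul_of_nonneg_right hm8 (by positivity)
        rw [div_mul_cancel₀ _ (by positivity)] at h1
        calc (κ[2 * t] ^ 2 * 4 ^ t) * ((m : ℝ) ^ (1 / 8 : ℝ))⁻¹ * αr ^ (a + b + 2 * s)
            ≤ ((m : ℝ) ^ (1 / 8 : ℝ) * ε ^ 2) * ((m : ℝ) ^ (1 / 8 : ℝ))⁻¹ * αr ^ (a + b + 2 * s) := by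
              gcongr
          _ = ε ^ 2 * αr ^ (a + b + 2 * s) := by
              field_simp

end Summit.PneNP.PneNP.Theorems.PaleySosRungWeilPatch
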